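import Mathlib.GroupTheory.SpecificGroups.Quaternion
import Mathlib.Data.ZMod.Basic
import HarnessLib

/-!
# The reduction homomorphism `Dic_n → Dic_m` (`n = m t`, `t` odd) and its kernel `⟨a^{2m}⟩`

COR-CM (cell `pub-hodgecm2`), binder seat b04 (gen 20), count-neutral claim DICYCLIC-TWO-SHEET, part XIV — group theory
(Mathlib only) for the ALL-TYPES programme of the dicyclic theorem (seat `A7-JUNCTION.md`, gen-20 plan): for a Galois CM
field `K` with `Gal(K/ℚ) ≅ Dic_n`, `n = 2^k q`, the unique proper CM subfield is the fixed field of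
`C_q = ⟨a^{2^{k+1}}⟩`, whose Galois group is the quotient `Dic_n / C_q ≅ Dic_{2^k} = Q_{2^{k+2}}`.  Here, for
`n = m t` with `t` ODD (so that `a^n ↦ a^m`: `n ≡ m (mod 2m)`):

* `exists_reductionHom` — a homomorphism `f : QuaternionGroup n →* QuaternionGroup m` with `f (a i) = a (cast i)`,
  `f (xa i) = xa (cast i)` (`cast : ℤ/2n → ℤ/2m`); stated as an existence (no definition is introduced);
* `reductionHom_surjective`, `reductionHom_a_n` (`f (a n) = a m`: the central involution goes to the central
  involution), and the FIBRES `reductionHom_eq_iff`: `f g₁ = f g₂ ↔ ∃ s, g₂ = a(2m)^s g₁` — so a subset of `Dic_n` is a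
  union of fibres of `f` iff it is stable under left translation by `a^{2m}` (part XIII's criterion for imprimitivity,
  with `2m = 2^{k+1}`).

KERNEL ONLY: theorems; no definition, no named fact, no `sorry`.

## References

* [Dodson1984] B. Dodson, *The structure of Galois groups of CM-fields*, Trans. AMS 283 (1984), §2 (imprimitivity
  sequences `G ⊃ H' ⊃ H`).
-/

namespace Summit.HodgeConjecture.CorCM.GaloisDicyclic

open QuaternionGroup

section Reduction

variable {n m t : ℕ}

/-- `2m ∣ 2n` for `n = m t`. [folklore] -/
theorem two_mul_dvd_two_mul (hnm : n = m * t) : 2 * m ∣ 2 * n := ⟨t, by rw [hnm]; ring⟩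

/-- For `t` odd, `n = m t ≡ m (mod 2m)`: the cast of `n ∈ ℤ/2n` to `ℤ/2m` is `m`. [folklore] -/
theorem cast_natCast_n (hnm : n = m * t) (ht : Odd t) :
    (ZMod.cast ((n : ℕ) : ZMod (2 * n)) : ZMod (2 * m)) = (m : ZMod (2 * m)) := by
  rw [ZMod.cast_natCast (two_mul_dvd_two_mul hnm)]
  obtain ⟨s, rfl⟩ := ht
  rw [hnm, show m * (2 * s + 1) = 2 * m * s + m by ring, Nat.cast_add, Nat.cast_mul, ZMod.natCast_self, zero_mul,
    zero_add]

/-- **The reduction homomorphism `Dic_n → Dic_m`** (`n = m t`, `t` odd): `a i ↦ a (i mod 2m)`, `xa i ↦ xa (i mod 2m)`.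
[folklore] -/
theorem exists_reductionHom (hnm : n = m * t) (ht : Odd t) :
    ∃ f : QuaternionGroup n →* QuaternionGroup m,
      (∀ i : ZMod (2 * n), f (a i) = a (ZMod.castHom (two_mul_dvd_two_mul hnm) (ZMod (2 * m)) i)) ∧
      (∀ i : ZMod (2 * n), f (xa i) = xa (ZMod.castHom (two_mul_dvd_two_mul hnm) (ZMod (2 * m)) i)) := by
  set c := ZMod.castHom (two_mul_dvd_two_mul hnm) (ZMod (2 * m)) with hc
  have hcn : c (n : ZMod (2 * n)) = (m : ZMod (2 * m)) := by
    rw [hc, ZMod.castHom_apply, cast_natCast_n hnm ht]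
  let F : QuaternionGroup n → QuaternionGroup m := fun g => match g with
    | a i => a (c i)
    | xa i => xa (c i)
  refine ⟨MonoidHom.mk' F ?_, fun i => rfl, fun i => rfl⟩
  rintro (i | i) (j | j)
  · change a (c (i + j)) = a (c i) * a (c j)
    rw [a_mul_a, map_add]
  · change xa (c (j - i)) = a (c i) * xa (c j)
    rw [a_mul_xa, map_sub]
  · change xa (c (i + j)) = xa (c i) * a (c j)
    rw [xa_mul_a, map_add]
  · change a (c ((n : ZMod (2 * n)) + j - i)) = xa (c i) * xa (c j)
    rw [xa_mul_xa, map_sub, map_add, hcn]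

/-- Lifting residues: `cast ((j.val : ℕ) : ℤ/2n) = j` in `ℤ/2m`. [folklore] -/
theorem cast_natCast_val [NeZero m] (hnm : n = m * t) (j : ZMod (2 * m)) :
    (ZMod.castHom (two_mul_dvd_two_mul hnm) (ZMod (2 * m))) ((j.val : ℕ) : ZMod (2 * n)) = j := by
  rw [map_natCast, ZMod.natCast_zmod_val]

/-- **The reduction homomorphism is surjective.** [folklore] -/
theorem reductionHom_surjective [NeZero m] (hnm : n = m * t) {f : QuaternionGroup n →* QuaternionGroup m}
    (hfa : ∀ i : ZMod (2 * n), f (a i) = a (ZMod.castHom (two_mul_dvd_two_mul hnm) (ZMod (2 * m)) i))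
    (hfx : ∀ i : ZMod (2 * n), f (xa i) = xa (ZMod.castHom (two_mul_dvd_two_mul hnm) (ZMod (2 * m)) i)) :
    Function.Surjective f := by
  rintro (j | j)
  · exact ⟨a ((j.val : ℕ) : ZMod (2 * n)), by rw [hfa, cast_natCast_val hnm]⟩
  · exact ⟨xa ((j.val : ℕ) : ZMod (2 * n)), by rw [hfx, cast_natCast_val hnm]⟩

/-- **The central involution goes to the central involution**: `f (a n) = a m`. [folklore] -/
theorem reductionHom_a_n (hnm : n = m * t) (ht : Odd t) {f : QuaternionGroup n →* QuaternionGroup m}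
    (hfa : ∀ i : ZMod (2 * n), f (a i) = a (ZMod.castHom (two_mul_dvd_two_mul hnm) (ZMod (2 * m)) i)) :
    f (a n) = a m := by
  rw [hfa, ZMod.castHom_apply, cast_natCast_n hnm ht]

/-- The kernel of the cast `ℤ/2n → ℤ/2m` consists of the multiples of `2m`. [folklore] -/
theorem cast_eq_zero_iff [NeZero n] (hnm : n = m * t) (i : ZMod (2 * n)) :
    (ZMod.castHom (two_mul_dvd_two_mul hnm) (ZMod (2 * m))) i = 0 ↔
      ∃ s : ℕ, i = ((2 * m * s : ℕ) : ZMod (2 * n)) := by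
  constructor
  · intro h
    rw [← ZMod.natCast_zmod_val i, map_natCast, ZMod.natCast_eq_zero_iff] at h
    obtain ⟨s, hs⟩ := h
    exact ⟨s, by rw [← ZMod.natCast_zmod_val i, hs]⟩
  · rintro ⟨s, rfl⟩
    rw [map_natCast, ZMod.natCast_eq_zero_iff]
    exact ⟨s, rfl⟩

/-- Powers of `a (2m)`: `a(2m)^s = a (2m s)`. [folklore] -/
theorem a_two_mul_pow (s : ℕ) :
    (a ((2 * m : ℕ) : ZMod (2 * n)) : QuaternionGroup n) ^ s = a ((2 * m * s : ℕ) : ZMod (2 * n)) := by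
  induction s with
  | zero => rw [pow_zero, mul_zero, Nat.cast_zero, one_def]
  | succ s ih => rw [pow_succ, ih, a_mul_a, ← Nat.cast_add, Nat.mul_succ]

/-- **Fibres of the reduction homomorphism**: `f g₁ = f g₂ ↔ g₂ = a(2m)^s · g₁` for some `s` — a subset of `Dic_n` is
a union of fibres iff it is stable under the left translation by `a^{2m}`. [folklore] -/
theorem reductionHom_eq_iff [NeZero n] (hnm : n = m * t) {f : QuaternionGroup n →* QuaternionGroup m}
    (hfa : ∀ i : ZMod (2 * n), f (a i) = a (ZMod.castHom (two_mul_dvd_two_mul hnm) (ZMod (2 * m)) i))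
    (hfx : ∀ i : ZMod (2 * n), f (xa i) = xa (ZMod.castHom (two_mul_dvd_two_mul hnm) (ZMod (2 * m)) i))
    (g₁ g₂ : QuaternionGroup n) :
    f g₁ = f g₂ ↔ ∃ s : ℕ, g₂ = (a ((2 * m : ℕ) : ZMod (2 * n))) ^ s * g₁ := by
  set c := ZMod.castHom (two_mul_dvd_two_mul hnm) (ZMod (2 * m)) with hc
  constructor
  · intro h
    -- `f (g₂ g₁⁻¹) = 1`, and `g₂ g₁⁻¹ = a i` with `c i = 0`
    have h1 : f (g₂ * g₁⁻¹) = 1 := by rw [map_mul, map_inv, ← h, mul_inv_cancel]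
    have key : ∀ g : QuaternionGroup n, f g = 1 → ∃ s : ℕ, g = (a ((2 * m : ℕ) : ZMod (2 * n))) ^ s := by
      rintro (i | i) hg
      · rw [hfa, one_def] at hg
        have hi : c i = 0 := a.inj hg
        obtain ⟨s, hs⟩ := (cast_eq_zero_iff hnm i).1 hi
        exact ⟨s, by rw [a_two_mul_pow, ← hs]⟩
      · rw [hfx, one_def] at hg
        exact absurd hg (by intro h'; cases h')
    obtain ⟨s, hs⟩ := key _ h1
    exact ⟨s, by rw [← hs, inv_mul_cancel_right]⟩
  · rintro ⟨s, rfl⟩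
    rw [map_mul, map_pow, hfa, (cast_eq_zero_iff hnm _).2 ⟨1, by rw [mul_one]⟩, ← one_def, one_pow, one_mul]

/-- In particular **the kernel is `⟨a^{2m}⟩`**: `f g = 1 ↔ g = a(2m)^s` for some `s`. [folklore] -/
theorem reductionHom_eq_one_iff [NeZero n] (hnm : n = m * t) {f : QuaternionGroup n →* QuaternionGroup m}
    (hfa : ∀ i : ZMod (2 * n), f (a i) = a (ZMod.castHom (two_mul_dvd_two_mul hnm) (ZMod (2 * m)) i))
    (hfx : ∀ i : ZMod (2 * n), f (xa i) = xa (ZMod.castHom (two_mul_dvd_two_mul hnm) (ZMod (2 * m)) i))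
    (g : QuaternionGroup n) : f g = 1 ↔ ∃ s : ℕ, g = (a ((2 * m : ℕ) : ZMod (2 * n))) ^ s := by
  rw [← map_one f, eq_comm, reductionHom_eq_iff hnm hfa hfx 1 g]
  simp only [mul_one]

end Reduction

end Summit.HodgeConjecture.CorCM.GaloisDicyclic
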